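import Literature.Analysis.ODE.SymmetricSemigroupBounds
import Mathlib.Analysis.Normed.Algebra.MatrixExponential
import Mathlib.Analysis.Calculus.MeanValue
import Mathlib.Analysis.Calculus.Deriv.Pow
import Mathlib.Analysis.Calculus.Deriv.Prod
import HarnessLib

/-!
# K1L `LagrangianRenormalisationStep(Design)` (K1L_D, stmt-AnomalousDissipation-27980; aside 24912), stub `stub_cellLawV0_IS`
# — W2 (i): the matrix semigroup `e^{-τB}` ON AN INVARIANT HYPERPLANE (constraint preservation, energy bounds, Loewner pinch)
# (helper; `--supports stmt-AnomalousDissipation-27980`; word-independent)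

Summits-side helper file of route `SolenoidalFractalHomogenisation` (planner ad-ideate-p5's STUB-PLAN for `stub_cellLawV`,
`Cruxes/LagrangianRenormalisationStep/STUB-IDEAS-stub_cellLawV-p5.md` §1 (W) step W1 / `LoewnerWindowSketch` S2 «QSPinch», tenure WORKER FIT v2
item W2; first of three files: this one, `…CellLawVQSResp.lean` (the slot response `qsResp`), `…CellLawVQSPinch.lean` (the tensor statement)).

For `B : Matrix (Fin m) (Fin m) ℝ` and the semigroup `e^{-τB}` (`NormedSpace.exp (-(τ • B))` acting by `*ᵥ`, derivative
`hasDerivAt_exp_neg_smul_mulVec` of ad-lit's `LinearPeriodicAveraging`, p635350): if `u` is a LEFT eigenvector (`Σᵢ uᵢ Bᵢⱼ = c uⱼ`) then the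
hyperplane `u^⊥` is invariant, `u ⬝ v = 0 ⇒ u ⬝ e^{-τB} v = 0` for all `τ` (`sum_mul_exp_neg_smul_mulVec_eq_zero`: `y = u ⬝ e^{-τB}v` solves
`y' = -cy`, `y(0) = 0`); the energy method of ad-lit's `SymmetricSemigroupBounds` (p636892; Khalil Thm 4.10 with `V = ‖x‖²`, Horn–Johnson Thm 4.2.2)
run with the quadratic-form bounds `a|w|² ≤ wᵀBw ≤ b|w|²` assumed ONLY on `u^⊥` gives `e^{-2bτ}|v|² ≤ |e^{-τB}v|² ≤ e^{-2aτ}|v|²` for `v ⊥ u`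
(`sum_sq_exp_neg_smul_mulVec_le_of_perp` / `le_sum_sq_exp_neg_smul_mulVec_of_perp`) and, for symmetric `B`, THE LOEWNER PINCH ON `u^⊥`:
`e^{-bτ}|v|² ≤ vᵀe^{-τB}v ≤ e^{-aτ}|v|²` (`sum_mul_exp_neg_smul_mulVec_le_of_perp` / `le_sum_mul_exp_neg_smul_mulVec_of_perp`, by name over
`dotProduct_exp_neg_smul_mulVec_eq_sum_sq`).  Use: the regularised transverse block `B̂ = PΣP + m̂m̂ᵀ` of the quasi-static cell response `excQS`
has `m̂` as a (left) eigenvector and is windowed by `NearIso` only on `m̂^⊥`, so the global pinch of p636892 is not enough when `1 ∉ [a, b]`.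
Everything PROVED, no named facts, no sorry.  Infrastructure for route-1's rung leaf F-D1.A0 (frontier FORMAL rung); NOT a proof of the stub,
of the crux, of Onsager's conjecture or of anomalous dissipation.  Prover seat `ad-k1l-cellLawV-w1` g0, 2026-08-28.
-/

set_option linter.dupNamespace false

noncomputable section

namespace Summit.AnomalousDissipation.AnomalousDissipation.Theorems.SolenoidalFractalHomogenisation.LagrangianStep

open Literature.Analysis.ODE.PeriodicAveraging

/-! ## §1 The matrix semigroup `e^{-τB}` on an invariant hyperplane -/

section Constrained

variable {m : ℕ}

/-- `Σᵢ vᵢ (M w)ᵢ = Σᵢⱼ vᵢ Mᵢⱼ wⱼ` (unfolding `Matrix.mulVec`). [folklore] -/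
theorem sum_mul_mulVec_eq_sum_sum (M : Matrix (Fin m) (Fin m) ℝ) (v w : Fin m → ℝ) :
    ∑ i, v i * M.mulVec w i = ∑ i, ∑ j, v i * M i j * w j := by
  simp only [Matrix.mulVec, dotProduct, Finset.mul_sum, mul_assoc]

/-- The orbit `u ↦ e^{-uB} v` is continuous. [folklore] -/
theorem continuous_exp_neg_smul_mulVec (B : Matrix (Fin m) (Fin m) ℝ) (v : Fin m → ℝ) :
    Continuous fun u : ℝ => (NormedSpace.exp (-(u • B))).mulVec v :=
  continuous_iff_continuousAt.2 fun u => (hasDerivAt_exp_neg_smul_mulVec B v u).continuousAt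

/-- The entries of `u ↦ e^{uB}` are continuous. [folklore] -/
theorem continuous_exp_smul_apply (B : Matrix (Fin m) (Fin m) ℝ) (i j : Fin m) :
    Continuous fun u : ℝ => NormedSpace.exp (u • B) i j := by
  have h := ((continuous_apply i).comp (continuous_exp_neg_smul_mulVec B (Pi.single j 1))).comp
    continuous_neg
  refine h.congr fun u => ?_
  simp only [Function.comp_apply, neg_smul, neg_neg, Matrix.mulVec, dotProduct, Pi.single_apply, mul_ite,
    mul_one, mul_zero, Finset.sum_ite_eq', Finset.mem_univ, if_true]

/-- A LEFT eigenvector turns `B *ᵥ` into a scalar inside the pairing: `Σᵢ uᵢ (B z)ᵢ = c Σⱼ uⱼ zⱼ`. [folklore] -/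
theorem sum_mul_mulVec_of_left_eig {B : Matrix (Fin m) (Fin m) ℝ} {u : Fin m → ℝ} {c : ℝ}
    (hu : ∀ j, ∑ i, u i * B i j = c * u j) (z : Fin m → ℝ) :
    ∑ i, u i * B.mulVec z i = c * ∑ j, u j * z j := by
  rw [sum_mul_mulVec_eq_sum_sum, Finset.sum_comm, Finset.mul_sum]
  refine Finset.sum_congr rfl fun j _ => ?_
  rw [← Finset.sum_mul, hu j]
  ring

/-- Derivative of a fixed pairing along the orbit. [folklore] -/
private theorem hasDerivAt_sum_mul_orbit (B : Matrix (Fin m) (Fin m) ℝ) (u v : Fin m → ℝ) (s : ℝ) :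
    HasDerivAt (fun s : ℝ => ∑ i, u i * (NormedSpace.exp (-(s • B))).mulVec v i)
      (∑ i, u i * (-(B.mulVec ((NormedSpace.exp (-(s • B))).mulVec v))) i) s := by
  have h := hasDerivAt_exp_neg_smul_mulVec B v s
  rw [hasDerivAt_pi] at h
  exact HasDerivAt.fun_sum fun i _ => (h i).const_mul (u i)

/-- **The constraint is preserved by the semigroup.**  If `u` is a left eigenvector of `B` (`Σᵢ uᵢBᵢⱼ = c uⱼ`) and `u ⬝ v = 0`,
then `u ⬝ e^{-τB} v = 0` for every `τ` (`y = u ⬝ e^{-τB}v` solves `y' = -c y`, `y(0) = 0`). [folklore] -/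
theorem sum_mul_exp_neg_smul_mulVec_eq_zero (B : Matrix (Fin m) (Fin m) ℝ) {u : Fin m → ℝ} {c : ℝ}
    (hu : ∀ j, ∑ i, u i * B i j = c * u j) {v : Fin m → ℝ} (hv : ∑ i, u i * v i = 0) (τ : ℝ) :
    ∑ i, u i * (NormedSpace.exp (-(τ • B))).mulVec v i = 0 := by
  set y : ℝ → ℝ := fun s => ∑ i, u i * (NormedSpace.exp (-(s • B))).mulVec v i with hy
  have hyd : ∀ s, HasDerivAt y (-(c * y s)) s := by
    intro s
    have h := hasDerivAt_sum_mul_orbit B u v s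
    have heq : ∑ i, u i * (-(B.mulVec ((NormedSpace.exp (-(s • B))).mulVec v))) i = -(c * y s) := by
      simp only [Pi.neg_apply, mul_neg, Finset.sum_neg_distrib]
      rw [sum_mul_mulVec_of_left_eig hu]
    rw [heq] at h
    exact h
  have hF : ∀ s, HasDerivAt (fun s => Real.exp (c * s) * y s) 0 s := by
    intro s
    have h1 : HasDerivAt (fun s => Real.exp (c * s)) (Real.exp (c * s) * c) s := by
      have := ((hasDerivAt_id s).const_mul c).exp
      simpa using this
    refine (h1.fun_mul (hyd s)).congr_deriv ?_
    ring
  have hconst := is_const_of_deriv_eq_zero (𝕜 := ℝ) (f := fun s => Real.exp (c * s) * y s)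
    (fun s => (hF s).differentiableAt) (fun s => (hF s).deriv) τ 0
  have hy0 : y 0 = 0 := by
    simp only [hy, zero_smul, neg_zero, NormedSpace.exp_zero, Matrix.one_mulVec]
    exact hv
  have h1 : Real.exp (c * τ) * y τ = 0 := by
    have : Real.exp (c * τ) * y τ = Real.exp (c * 0) * y 0 := hconst
    rw [this, hy0, mul_zero]
  exact (mul_eq_zero.1 h1).resolve_left (Real.exp_pos _).ne'

/-- The constrained energy method: derivative of `Σᵢ zᵢ²` along the orbit. [folklore] -/
private theorem hasDerivAt_energy_orbit (B : Matrix (Fin m) (Fin m) ℝ) (v : Fin m → ℝ) (s : ℝ) :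
    HasDerivAt (fun s : ℝ => ∑ i, ((NormedSpace.exp (-(s • B))).mulVec v i) ^ 2)
      (-2 * ∑ i, ∑ j, (NormedSpace.exp (-(s • B))).mulVec v i * B i j *
        (NormedSpace.exp (-(s • B))).mulVec v j) s := by
  have h := hasDerivAt_exp_neg_smul_mulVec B v s
  rw [hasDerivAt_pi] at h
  have h2 := HasDerivAt.fun_sum (u := Finset.univ) fun i _ => (h i).fun_pow 2
  refine h2.congr_deriv ?_
  rw [← sum_mul_mulVec_eq_sum_sum, Finset.mul_sum]
  refine Finset.sum_congr rfl fun i _ => ?_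
  simp only [Nat.cast_ofNat, Nat.add_one_sub_one, pow_one, Pi.neg_apply]
  ring

/-- **Upper semigroup bound on an invariant hyperplane** (no symmetry): `u` a left eigenvector of `B`,
`a Σwᵢ² ≤ Σᵢⱼ wᵢBᵢⱼwⱼ` for all `w ⊥ u`; then `Σᵢ ((e^{-τB}v)ᵢ)² ≤ e^{-2aτ} Σᵢ vᵢ²` for `v ⊥ u`, `τ ≥ 0`.
(Khalil's Thm 4.10 with `V = ‖x‖²`, restricted to the invariant subspace.) [folklore] -/
theorem sum_sq_exp_neg_smul_mulVec_le_of_perp (B : Matrix (Fin m) (Fin m) ℝ) {u : Fin m → ℝ} {c : ℝ}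
    (hu : ∀ j, ∑ i, u i * B i j = c * u j) {a : ℝ}
    (ha : ∀ w : Fin m → ℝ, ∑ i, u i * w i = 0 → a * ∑ i, w i ^ 2 ≤ ∑ i, ∑ j, w i * B i j * w j)
    {v : Fin m → ℝ} (hv : ∑ i, u i * v i = 0) {τ : ℝ} (hτ : 0 ≤ τ) :
    ∑ i, ((NormedSpace.exp (-(τ • B))).mulVec v i) ^ 2 ≤ Real.exp (-(2 * a * τ)) * ∑ i, v i ^ 2 := by
  set z : ℝ → Fin m → ℝ := fun s => (NormedSpace.exp (-(s • B))).mulVec v with hz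
  have hperp : ∀ s, ∑ i, u i * z s i = 0 := fun s => sum_mul_exp_neg_smul_mulVec_eq_zero B hu hv s
  set φ : ℝ → ℝ := fun s => Real.exp (2 * a * s) * ∑ i, z s i ^ 2 with hφ
  have hφd : ∀ s, HasDerivAt φ (Real.exp (2 * a * s) * (2 * a) * ∑ i, z s i ^ 2 +
      Real.exp (2 * a * s) * (-2 * ∑ i, ∑ j, z s i * B i j * z s j)) s := by
    intro s
    have h1 : HasDerivAt (fun s => Real.exp (2 * a * s)) (Real.exp (2 * a * s) * (2 * a)) s := by
      have := ((hasDerivAt_id s).const_mul (2 * a)).exp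
      simpa using this
    exact h1.fun_mul (hasDerivAt_energy_orbit B v s)
  have hφ' : ∀ s, Real.exp (2 * a * s) * (2 * a) * ∑ i, z s i ^ 2 +
      Real.exp (2 * a * s) * (-2 * ∑ i, ∑ j, z s i * B i j * z s j) ≤ 0 := by
    intro s
    have hc := ha (z s) (hperp s)
    have hpos := Real.exp_pos (2 * a * s)
    nlinarith
  have hanti : Antitone φ := antitone_of_hasDerivAt_nonpos hφd fun s => hφ' s
  have hφτ : φ τ ≤ φ 0 := hanti hτ
  have hφ0 : φ 0 = ∑ i, v i ^ 2 := by
    simp [hφ, hz]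
  rw [hφ0] at hφτ
  have hexp : Real.exp (-(2 * a * τ)) * Real.exp (2 * a * τ) = 1 := by
    rw [← Real.exp_add, neg_add_cancel, Real.exp_zero]
  have hpos := Real.exp_pos (-(2 * a * τ))
  calc ∑ i, (z τ i) ^ 2 = Real.exp (-(2 * a * τ)) * φ τ := by
        rw [hφ, ← mul_assoc, hexp, one_mul]
    _ ≤ Real.exp (-(2 * a * τ)) * ∑ i, v i ^ 2 := mul_le_mul_of_nonneg_left hφτ hpos.le

/-- **Lower semigroup bound on an invariant hyperplane** (no symmetry): `u` a left eigenvector of `B`,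
`Σᵢⱼ wᵢBᵢⱼwⱼ ≤ b Σwᵢ²` for all `w ⊥ u`; then `e^{-2bτ} Σᵢ vᵢ² ≤ Σᵢ ((e^{-τB}v)ᵢ)²` for `v ⊥ u`, `τ ≥ 0`. [folklore] -/
theorem le_sum_sq_exp_neg_smul_mulVec_of_perp (B : Matrix (Fin m) (Fin m) ℝ) {u : Fin m → ℝ} {c : ℝ}
    (hu : ∀ j, ∑ i, u i * B i j = c * u j) {b : ℝ}
    (hb : ∀ w : Fin m → ℝ, ∑ i, u i * w i = 0 → ∑ i, ∑ j, w i * B i j * w j ≤ b * ∑ i, w i ^ 2)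
    {v : Fin m → ℝ} (hv : ∑ i, u i * v i = 0) {τ : ℝ} (hτ : 0 ≤ τ) :
    Real.exp (-(2 * b * τ)) * ∑ i, v i ^ 2 ≤ ∑ i, ((NormedSpace.exp (-(τ • B))).mulVec v i) ^ 2 := by
  set z : ℝ → Fin m → ℝ := fun s => (NormedSpace.exp (-(s • B))).mulVec v with hz
  have hperp : ∀ s, ∑ i, u i * z s i = 0 := fun s => sum_mul_exp_neg_smul_mulVec_eq_zero B hu hv s
  set φ : ℝ → ℝ := fun s => Real.exp (2 * b * s) * ∑ i, z s i ^ 2 with hφ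
  have hφd : ∀ s, HasDerivAt φ (Real.exp (2 * b * s) * (2 * b) * ∑ i, z s i ^ 2 +
      Real.exp (2 * b * s) * (-2 * ∑ i, ∑ j, z s i * B i j * z s j)) s := by
    intro s
    have h1 : HasDerivAt (fun s => Real.exp (2 * b * s)) (Real.exp (2 * b * s) * (2 * b)) s := by
      have := ((hasDerivAt_id s).const_mul (2 * b)).exp
      simpa using this
    exact h1.fun_mul (hasDerivAt_energy_orbit B v s)
  have hφ' : ∀ s, 0 ≤ Real.exp (2 * b * s) * (2 * b) * ∑ i, z s i ^ 2 +
      Real.exp (2 * b * s) * (-2 * ∑ i, ∑ j, z s i * B i j * z s j) := by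
    intro s
    have hc := hb (z s) (hperp s)
    have hpos := Real.exp_pos (2 * b * s)
    nlinarith
  have hmono : Monotone φ := monotone_of_hasDerivAt_nonneg hφd fun s => hφ' s
  have hφτ : φ 0 ≤ φ τ := hmono hτ
  have hφ0 : φ 0 = ∑ i, v i ^ 2 := by
    simp [hφ, hz]
  rw [hφ0] at hφτ
  have hexp : Real.exp (-(2 * b * τ)) * Real.exp (2 * b * τ) = 1 := by
    rw [← Real.exp_add, neg_add_cancel, Real.exp_zero]
  have hpos := Real.exp_pos (-(2 * b * τ))
  calc Real.exp (-(2 * b * τ)) * ∑ i, v i ^ 2 ≤ Real.exp (-(2 * b * τ)) * φ τ :=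
        mul_le_mul_of_nonneg_left hφτ hpos.le
    _ = ∑ i, (z τ i) ^ 2 := by rw [hφ, ← mul_assoc, hexp, one_mul]

/-- **THE LOEWNER PINCH ON AN INVARIANT HYPERPLANE, upper half** (symmetric `B`, eigenvector `u`, `a|w|² ≤ wᵀBw` on `u^⊥`):
`Σᵢⱼ vᵢ (e^{-τB})ᵢⱼ vⱼ ≤ e^{-aτ} Σᵢ vᵢ²` for `v ⊥ u`, `τ ≥ 0`. [folklore] -/
theorem sum_mul_exp_neg_smul_mulVec_le_of_perp {B : Matrix (Fin m) (Fin m) ℝ} (hB : B.IsSymm) {u : Fin m → ℝ}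
    {c : ℝ} (hu : ∀ j, ∑ i, u i * B i j = c * u j) {a : ℝ}
    (ha : ∀ w : Fin m → ℝ, ∑ i, u i * w i = 0 → a * ∑ i, w i ^ 2 ≤ ∑ i, ∑ j, w i * B i j * w j)
    {v : Fin m → ℝ} (hv : ∑ i, u i * v i = 0) {τ : ℝ} (hτ : 0 ≤ τ) :
    ∑ i, v i * (NormedSpace.exp (-(τ • B))).mulVec v i ≤ Real.exp (-(a * τ)) * ∑ i, v i ^ 2 := by
  rw [dotProduct_exp_neg_smul_mulVec_eq_sum_sq hB]
  have h := sum_sq_exp_neg_smul_mulVec_le_of_perp B hu ha hv (by linarith : 0 ≤ τ / 2)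
  convert h using 2
  ring_nf

/-- **THE LOEWNER PINCH ON AN INVARIANT HYPERPLANE, lower half** (symmetric `B`, eigenvector `u`, `wᵀBw ≤ b|w|²` on `u^⊥`):
`e^{-bτ} Σᵢ vᵢ² ≤ Σᵢⱼ vᵢ (e^{-τB})ᵢⱼ vⱼ` for `v ⊥ u`, `τ ≥ 0`. [folklore] -/
theorem le_sum_mul_exp_neg_smul_mulVec_of_perp {B : Matrix (Fin m) (Fin m) ℝ} (hB : B.IsSymm) {u : Fin m → ℝ}
    {c : ℝ} (hu : ∀ j, ∑ i, u i * B i j = c * u j) {b : ℝ}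
    (hb : ∀ w : Fin m → ℝ, ∑ i, u i * w i = 0 → ∑ i, ∑ j, w i * B i j * w j ≤ b * ∑ i, w i ^ 2)
    {v : Fin m → ℝ} (hv : ∑ i, u i * v i = 0) {τ : ℝ} (hτ : 0 ≤ τ) :
    Real.exp (-(b * τ)) * ∑ i, v i ^ 2 ≤ ∑ i, v i * (NormedSpace.exp (-(τ • B))).mulVec v i := by
  rw [dotProduct_exp_neg_smul_mulVec_eq_sum_sq hB]
  have h := le_sum_sq_exp_neg_smul_mulVec_of_perp B hu hb hv (by linarith : 0 ≤ τ / 2)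
  convert h using 2
  ring_nf

end Constrained

end Summit.AnomalousDissipation.AnomalousDissipation.Theorems.SolenoidalFractalHomogenisation.LagrangianStep

end
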